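import Mathlib
import HarnessLib

/-!
# LINE (A) `product_plus_one` (crux `MatrixDescartes`, stmt-ValiantsHypothesis-18050, V1) — THE PHASE LENS, CLOUD PROFILES (pure algebra):
# p3 g20's (C1)/(C5) — the height-`π/c` and height-`π/b` profiles of a one-change trinomial row — and the two root-of-unity facts they use

Companion of ✓⧗ `…ProductPlusOneLensAlgebra` (σ/τ letters).  Source: `pub/val-lit/lmr/NOTE-p3g20-18050-phase-lens.md` rev 3 §6′ (C1)/(C2), §6″ (C5) (val-lit-p3 g20;
crit-1 g8 #311), pen memo §36.4–§36.5.  A one-change trinomial row normalised to `f(X) = 1 + s₁μX^a + s₂X^c` (`s₁, s₂ = ±1`, `c = a + b`) has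
`T_f = θ log f = N/D` with `N = a s₁μX^a + c s₂X^c` evaluated at the rotated point; on the line of height `π/c` one uses `ω = e^{iπ/c}`, `ω^c = −1`,
`ω^a = e^{iφ}`, `φ = πa/c`, and on the line of height `π/b`: `(Xe^{iπ/b})^c = −e^{iθ}X^c`, `(Xe^{iπ/b})^a = e^{iθ}X^a`, `θ = πa/b`.  THIS FILE:
* `lens_halfTurn_pow` : `(e^{πi/c})^c = −1`;  `lens_rootPhase_pow` : `(e^{πi/c})^a = cos(πa/c) + i sin(πa/c)`  (the analytic inputs, `Complex.exp_nat_mul`);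
* ★ (C1) `lens_cloud_profile_num_c` : with `e^{iφ} = co + i·si` and the `c`-letter already turned real (`ω^c = −1`),
  `Im(N·conj D) = s₁μ·si·X^a·(a + (c − a)·s₂·X^c)` for `N = a s₁μX^a(co + i si) − c s₂X^c`, `D = 1 + s₁μX^a(co + i si) − s₂X^c` — PURE ALGEBRA (no
  `co² + si² = 1` needed): T5 `(−,−)` ⇒ `μ si X^a(bX^c − a)`, T4 `(+,−)` ⇒ `μ si X^a(a − bX^c)`, T1 ⇒ `μ si X^a(a + bX^c)` — single-node dipoles / positive;
  `lens_cloud_den_im_c` : `Im D = s₁μ·si·X^a` (so `D ≠ 0` off `si = 0`: (C2), no root of a one-change trinomial at argument `±π/c`);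
* ★ (C5) `lens_cloud_profile_num_b` : with `G = s₁μX^a − s₂X^c`, `G̃ = a s₁μX^a − c s₂X^c` real (no `co² + si² = 1` needed either),
  `Im((co + i si)G̃ · conj(1 + (co + i si)G)) = si·G̃` — T4's `G̃ = aμX^a + cX^c > 0`: DEFINITE at height `π/b`.
Profiles = these numerators over `|D|² > 0`.  HONEST FRAMING: algebra only (helper); the lens's counts are PAPER (memo §36 / the NOTE); nothing about
`WronskianBudgetK3` / `OneChangeFloorK3` / 18050 / `MatrixDescartes`; `VP ≠ VNP` is NOT proved.  No definitions, no named facts, no sorry.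
-/

set_option linter.dupNamespace false

namespace Summit.ValiantsHypothesis.ValiantsHypothesis.Theorems.LacunarySymmetroidMatrixDescartes

namespace ProductPlusOne

open Complex

/-! ### §1 The two root-of-unity facts -/

/-- `(e^{πi/c})^c = −1` (`c ≠ 0`): the `c`-letter turns REAL (negative) on the line of height `π/c`. [this file's lemma] -/
theorem lens_halfTurn_pow (c : ℕ) (hc : c ≠ 0) : exp (Real.pi * I / c) ^ c = -1 := by
  rw [← exp_nat_mul]
  have h : (c : ℂ) * (Real.pi * I / c) = Real.pi * I := by
    have hc' : (c : ℂ) ≠ 0 := by exact_mod_cast hc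
    field_simp
  rw [h, exp_pi_mul_I]

/-- `(e^{πi/c})^a = cos(πa/c) + i·sin(πa/c)`: the `a`-letter turns by the phase `φ = πa/c`. [this file's lemma] -/
theorem lens_rootPhase_pow (a c : ℕ) :
    exp (Real.pi * I / c) ^ a = (Real.cos (Real.pi * a / c) : ℂ) + (Real.sin (Real.pi * a / c) : ℂ) * I := by
  rw [← exp_nat_mul, Complex.ofReal_cos, Complex.ofReal_sin, ← exp_mul_I]
  congr 1
  push_cast
  ring

/-! ### §2 (C1): the height-`π/c` profile numerator -/

/-- ★ **(C1) cloud profile at height `π/c`, numerator** (pure algebra): `N = a s₁μX^a(co + i si) − c s₂X^c`, `D = 1 + s₁μX^a(co + i si) − s₂X^c` ⇒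
`Im(N·conj D) = s₁μ·si·X^a·(a + (c − a)s₂X^c)`. [this file's theorem] -/
theorem lens_cloud_profile_num_c (s₁ s₂ μ Xa Xc a c co si : ℝ) :
    ((((a * s₁ * μ * Xa : ℝ) : ℂ) * ((co : ℂ) + (si : ℂ) * I) - ((c * s₂ * Xc : ℝ) : ℂ))
        * (starRingEnd ℂ) (1 + ((s₁ * μ * Xa : ℝ) : ℂ) * ((co : ℂ) + (si : ℂ) * I) - ((s₂ * Xc : ℝ) : ℂ))).im
      = s₁ * μ * si * Xa * (a + (c - a) * s₂ * Xc) := by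
  simp only [mul_im, mul_re, sub_im, sub_re, add_im, add_re, ofReal_re, ofReal_im, I_re, I_im, one_re, one_im,
    conj_re, conj_im, mul_zero, mul_one, zero_mul, sub_zero, zero_add, add_zero]
  ring

/-- **(C2) input**: `Im D = s₁μ·si·X^a` — the rotated row value is off the real axis whenever `s₁μ si X^a ≠ 0`. [this file's lemma] -/
theorem lens_cloud_den_im_c (s₁ s₂ μ Xa Xc co si : ℝ) :
    (1 + ((s₁ * μ * Xa : ℝ) : ℂ) * ((co : ℂ) + (si : ℂ) * I) - ((s₂ * Xc : ℝ) : ℂ)).im = s₁ * μ * si * Xa := by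
  simp only [mul_im, sub_im, add_im, ofReal_re, ofReal_im, I_re, I_im, one_im, mul_zero, mul_one, zero_add, add_zero, sub_zero,
    zero_mul]
  ring

/-- (C2) as a non-vanishing statement. [this file's lemma] -/
theorem lens_cloud_den_ne_zero_c (s₁ s₂ μ Xa Xc co si : ℝ) (h : s₁ * μ * si * Xa ≠ 0) :
    1 + ((s₁ * μ * Xa : ℝ) : ℂ) * ((co : ℂ) + (si : ℂ) * I) - ((s₂ * Xc : ℝ) : ℂ) ≠ 0 := by
  intro h0
  have := congrArg Complex.im h0
  rw [lens_cloud_den_im_c, zero_im] at this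
  exact h this

/-! ### §3 (C5): the height-`π/b` profile numerator -/

/-- ★ **(C5) cloud profile at height `π/b`, numerator** (pure algebra, `G, G̃` real; the `co² + si²` term is real and drops out):
`Im((co + i si)·G̃ · conj(1 + (co + i si)·G)) = si·G̃` — at `(co, si) = (cos θ, sin θ)`, `θ = πa/b`: T4's `G̃ = aμX^a + cX^c > 0` ⇒ DEFINITE. [this file's theorem] -/
theorem lens_cloud_profile_num_b (G Gt co si : ℝ) :
    ((((co : ℂ) + (si : ℂ) * I) * (Gt : ℂ)) * (starRingEnd ℂ) (1 + ((co : ℂ) + (si : ℂ) * I) * (G : ℂ))).im = si * Gt := by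
  simp only [mul_im, mul_re, add_im, add_re, ofReal_re, ofReal_im, I_re, I_im, one_re, one_im, conj_re, conj_im, mul_zero, mul_one,
    sub_zero, zero_add, add_zero]
  ring

end ProductPlusOne

end Summit.ValiantsHypothesis.ValiantsHypothesis.Theorems.LacunarySymmetroidMatrixDescartes
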